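import Literature.Topology.FourManifolds.ArcClosing
import Literature.Topology.FourManifolds.CloseMapsHomotopic
import Literature.Topology.FourManifolds.PathClassTools

/-!
# Closing an embedded arc up to an embedded circle *through a prescribed path, keeping its
# class* (Milnor 1965, proof of Lemma 8.3 with Whitney's Lemma 6.12: "`g ≃ f`")

Topic `Literature/Topology/FourManifolds` (infrastructure for the fact seat
`provefact-Literature.Geometry.Riemannian.LawsonMichelsohn1984_surrounding`: Wall's form of the
trading of `1`-handles under `π₁(W, V) = 0`).  Everything here is **proved**.

Milnor, *Lectures on the h-cobordism theorem* (1965), proof of Lemma 8.3 (PDF p. 56), closes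
the small arc `D` through `q₀` to a circle by a path joining its ends off the right-hand
spheres and then invokes Whitney's **Lemma 6.12** (PDF p. 42): *there exists an imbedding
`g : M₁ → M₂` approximating `f` such that `g ≃ f` and `g|A = f|A`*.  The tree's
`Milnor1965_exists_embedding_circle_through_arc_holds` (`ArcClosing.lean`) keeps everything
but the clause *`g ≃ f`*, choosing the joining path by itself.  When only `π₁(W, V) = 0` is
available (Wall, *Geometrical connectivity I* (1971)) the class of the ideal circle matters,
so here the joining path is an **input** and the homotopy clause is **kept**:

* `exists_embedding_circle_through_arc_homotopic` — for a compact manifold `V` of dimension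
  `n ≥ 3`, an open `O ⊆ V`, a smooth injective immersion `γ : ℝ → V` with `γ t ∈ O` for
  `t ≠ 0`, and a path `pth` from `γ 1` to `γ (-1)` inside `O ∖ {γ 0}`: a smooth embedding
  `e : S¹ → V` with `e (1, 0) = γ 0`, `e s ∈ O` for `s ≠ (1, 0)`, `range e = γ[-1, 1]` near
  `γ 0`, **and whose loop `t ↦ e (cos 2πt, sin 2πt)` is homotopic rel `γ 0` to
  `γ|[0, 1] · pth · γ|[-1, 0]`** (for any paths `Ap`, `Am` tracing these two half-arcs).

Proof: as in `ArcClosing.lean` — the periodic map through `γ` and `pth` descends to a loop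
`L : S¹ → V`, is smoothed rel the arc (`exists_contMDiff_eqOn_mapsTo`) and put in general
position away from the arc (`exists_isSmoothEmbedding_of_stagesGoodOn_core`) — with, in both
steps, an additional finite family of closeness constraints `MapsTo · Cₖ (U yₖ)` for the cover
`U` of `exists_cover_homotopic_of_mapsTo` (`CloseMapsHomotopic.lean`), so that the three
circle maps are successively homotopic by homotopies not moving the base point; the loop of
`L` is the concatenation up to reparametrisation along the periodic map
(`homotopic_of_comp_real`).

## References

* J. Milnor, *Lectures on the h-cobordism theorem* (1965), proof of Lemma 8.3 (PDF pp. 55–56),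
  Lemma 6.12 (PDF p. 42). [MilnorHCobordism1965]
* H. Whitney, *Differentiable manifolds*, Ann. of Math. (2) 37 (1936), 645–680, §II Thms. 5–6.
  [Whitney1936]
-/

open scoped Manifold ContDiff Topology Real unitInterval
open Function Set Filter

noncomputable section

namespace Literature.Topology.FourManifolds

universe u

/-! ### Finite closeness families for a map of a compact metric space -/

section Cover

/-- **A finite family of compact pieces on which a continuous map is `U`-small.**  For a
continuous map `f` of a compact metric space `X` and open sets `U y ∋ y` of the target, there
are finitely many points `k` and radii such that the closed balls `B̄(k, r k)` cover `X` and
`f` maps each into `U (f k)`. [folklore] -/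
theorem exists_finset_closedBall_mapsTo {X V : Type*} [MetricSpace X] [CompactSpace X]
    [TopologicalSpace V] {U : V → Set V} (hUo : ∀ y, IsOpen (U y)) (hUy : ∀ y, y ∈ U y)
    {f : X → V} (hf : Continuous f) :
    ∃ (t : Finset X) (r : X → ℝ), (∀ k, 0 < r k) ∧ (∀ k, MapsTo f (Metric.closedBall k (r k)) (U (f k))) ∧
      (⋃ k ∈ t, Metric.closedBall k (r k)) = univ := by
  have hnhds : ∀ x : X, ∃ r > 0, Metric.closedBall x r ⊆ f ⁻¹' U (f x) := by
    intro x
    have hmem : f ⁻¹' U (f x) ∈ 𝓝 x := (hUo _).preimage hf |>.mem_nhds (hUy _)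
    obtain ⟨r, hr, hsub⟩ := Metric.mem_nhds_iff.1 hmem
    exact ⟨r / 2, by positivity, Metric.closedBall_subset_ball (by linarith) |>.trans hsub⟩
  choose r hr hsub using hnhds
  obtain ⟨t, -, hcover⟩ := isCompact_univ.elim_nhds_subcover (fun x => Metric.ball x (r x))
    fun x _ => Metric.ball_mem_nhds x (hr x)
  refine ⟨t, r, hr, fun k => fun x hx => hsub k hx, ?_⟩
  refine eq_univ_of_univ_subset (hcover.trans ?_)
  exact iUnion₂_mono fun k _ => Metric.ball_subset_closedBall

end Cover

/-! ### The exact periodic extension -/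

section Loop

variable {V : Type u} [TopologicalSpace V]

/-- **The `2π`-periodic map through the arc and the path, with its formula on the path part**
(`exists_periodic_extension` of `ArcClosing.lean` records only that the path part takes values
on the path). [folklore] -/
theorem exists_periodic_extension_eq {γ : ℝ → V} (hγ : Continuous γ) (pth : Path (γ 1) (γ (-1))) :
    ∃ P : ℝ → V, Continuous P ∧ Periodic P (2 * π) ∧ (∀ θ ∈ Icc (-1 : ℝ) 1, P θ = γ θ) ∧
      ∀ θ ∈ Icc (1 : ℝ) (2 * π - 1), P θ = pth.extend ((θ - 1) / (2 * π - 2)) := by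
  haveI : Fact (0 < 2 * π) := ⟨Real.two_pi_pos⟩
  have hπ : (1 : ℝ) < 2 * π - 1 := by linarith [Real.two_le_pi]
  set P₁ : ℝ → V := fun x => if x ≤ 1 then γ x else pth.extend ((x - 1) / (2 * π - 2)) with hP₁
  have hP₁c : Continuous P₁ := by
    refine Continuous.if_le hγ (pth.continuous_extend.comp (by fun_prop)) continuous_id
      continuous_const ?_
    rintro x rfl
    simp
  have hP₁ends : P₁ (-1) = P₁ (-1 + 2 * π) := by
    have h1 : P₁ (-1) = γ (-1) := by simp [hP₁]
    have h2 : P₁ (-1 + 2 * π) = pth.extend 1 := by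
      have hnot : ¬ (-1 + 2 * π ≤ 1) := by linarith
      have hne : (2 * π - 2 : ℝ) ≠ 0 := by linarith
      simp only [hP₁, hnot, if_false]
      congr 1
      rw [div_eq_one_iff_eq hne]
      ring
    rw [h1, h2, Path.extend_one]
  set P : ℝ → V := fun θ => AddCircle.liftIco (2 * π) (-1) P₁ (θ : AddCircle (2 * π)) with hP
  have hPc : Continuous P :=
    (AddCircle.liftIco_continuous hP₁ends hP₁c.continuousOn).comp (AddCircle.continuous_mk' _)
  have hPper : Periodic P (2 * π) := fun θ => by
    simp only [hP]
    rw [AddCircle.coe_add_period]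
  have hPeq : ∀ θ ∈ Ico (-1 : ℝ) (-1 + 2 * π), P θ = P₁ θ := fun θ hθ =>
    AddCircle.liftIco_coe_apply hθ
  refine ⟨P, hPc, hPper, fun θ hθ => ?_, fun θ hθ => ?_⟩
  · rw [hPeq θ ⟨hθ.1, by linarith [hθ.2]⟩]
    simp [hP₁, hθ.2]
  · rcases eq_or_lt_of_le hθ.2 with h | h
    · -- the end point `2π - 1`: one period after `-1`
      rw [h, show (2 * π - 1 : ℝ) = -1 + 2 * π by ring, hPper (-1),
        hPeq (-1) ⟨le_rfl, by linarith⟩]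
      have h1 : P₁ (-1) = γ (-1) := by simp [hP₁]
      have hne : (2 * π - 2 : ℝ) ≠ 0 := by linarith
      rw [h1, show (-1 + 2 * π - 1) / (2 * π - 2) = (1 : ℝ) by
        rw [div_eq_one_iff_eq hne]; ring, Path.extend_one]
    · rw [hPeq θ ⟨by linarith [hθ.1], by linarith⟩]
      rcases eq_or_lt_of_le hθ.1 with h1 | h1
      · rw [← h1]; simp [hP₁]
      · have hnot : ¬ θ ≤ 1 := not_le.2 h1
        simp only [hP₁, hnot, if_false]

end Loop

/-! ### The arc-closing lemma with class control -/

section ArcClosing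

variable {n : ℕ} {V : Type u} [TopologicalSpace V] [ChartedSpace (EuclideanSpace ℝ (Fin n)) V]
  [IsManifold (𝓡 n) ∞ V]

set_option backward.isDefEq.respectTransparency false in
/-- **Closing an embedded arc up to an embedded circle through a prescribed path, keeping the
class** (Milnor 1965, proof of Lemma 8.3 with Whitney's Lemma 6.12, including its clause
*"`g ≃ f`"*).  In a compact Hausdorff manifold `V` of dimension `n ≥ 3` let `O` be open,
`γ : ℝ → V` a smooth injective immersion with `γ t ∈ O` for `t ≠ 0`, and `pth` a path from
`γ 1` to `γ (-1)` inside `O` avoiding `γ 0`.  Then there is a smoothly embedded circle `e` with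
`e (1, 0) = γ 0`, `e s ∈ O` for `s ≠ (1, 0)`, `range e` equal to `γ[-1, 1]` near `γ 0`, and
whose loop `t ↦ e (cos 2πt, sin 2πt)` is homotopic rel end points to `Ap · pth · Am` for any
paths `Ap : γ 0 ⟶ γ 1`, `Am : γ (-1) ⟶ γ 0` tracing `γ` on `[0, 1]` and `[-1, 0]`.
[cite: MilnorHCobordism1965, proof of Lemma 8.3 (PDF p. 56) and Lemma 6.12 (PDF p. 42)] [cite: Whitney1936, §II Thm. 5] -/
theorem exists_embedding_circle_through_arc_homotopic [T2Space V] [SecondCountableTopology V]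
    [CompactSpace V] (hn : 3 ≤ n) {O : Set V} (hO : IsOpen O) (γ : ℝ → V)
    (hγs : ContMDiff 𝓘(ℝ, ℝ) (𝓡 n) ∞ γ) (hγinj : Injective γ)
    (hγimm : ∀ t, Injective (mfderiv 𝓘(ℝ, ℝ) (𝓡 n) γ t)) (hγO : ∀ t ≠ 0, γ t ∈ O)
    (pth : Path (γ 1) (γ (-1))) (hpth : ∀ t, pth t ∈ O ∧ pth t ≠ γ 0)
    (Ap : Path (γ 0) (γ 1)) (hAp : ∀ t : I, Ap t = γ t)
    (Am : Path (γ (-1)) (γ 0)) (hAm : ∀ t : I, Am t = γ ((t : ℝ) - 1)) :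
    ∃ e : C((Metric.sphere (0 : EuclideanSpace ℝ (Fin 2)) 1), V),
      Manifold.IsSmoothEmbedding (𝓡 1) (𝓡 n) ∞ e ∧
      e (circlePoint 0) = γ 0 ∧ (∀ s ≠ circlePoint 0, e s ∈ O) ∧
      (∃ U ∈ 𝓝 (γ 0), range e ∩ U = γ '' Icc (-1) 1 ∩ U) ∧
      ∃ h0 : γ 0 = e (circlePoint 0),
        (e.circleLoop.cast h0 h0).Homotopic ((Ap.trans pth).trans Am) := by
  have hγc : Continuous γ := hγs.continuous
  have hπ3 := Real.two_le_pi
  -- ### (0) the cover measuring closeness of circle maps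
  obtain ⟨Uc, hUco, hUcy, hUc⟩ := exists_cover_homotopic_of_mapsTo (n := n) V
  -- ### (1) the path
  have hpthO : range pth ⊆ O \ {γ 0} := by
    rintro _ ⟨t, rfl⟩
    exact ⟨(hpth t).1, (hpth t).2⟩
  -- ### (2) the continuous loop through the arc
  obtain ⟨P, hPc, hPper, hPγ, hPpth'⟩ := exists_periodic_extension_eq hγc pth
  have hPpth : ∀ θ ∈ Ioo (1 : ℝ) (2 * π - 1), P θ ∈ range pth := fun θ hθ => by
    rw [hPpth' θ ⟨hθ.1.le, hθ.2.le⟩]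
    exact Path.extend_mem_range pth _
  obtain ⟨L, hL⟩ := exists_fun_comp_circlePoint_eq hPper
  have hLP : L ∘ circlePoint = P := funext hL
  have hLc : Continuous L := continuous_of_comp_circlePoint (by rw [hLP]; exact hPc)
  have hLγ : ∀ θ : ℝ, |θ| ≤ 1 → L (circlePoint θ) = γ θ := fun θ hθ => by
    rw [hL]
    exact hPγ θ (abs_le.1 hθ)
  have hLsmooth : ∀ θ : ℝ, |θ| < 1 → ContMDiffAt (𝓡 1) (𝓡 n) ∞ L (circlePoint θ) := by
    intro θ hθ
    apply contMDiffAt_of_comp_circlePoint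
    have hev : (L ∘ circlePoint) =ᶠ[𝓝 θ] γ := by
      have ho : IsOpen {x : ℝ | |x| < 1} := isOpen_lt continuous_abs continuous_const
      filter_upwards [ho.mem_nhds hθ] with x hx
      exact hLγ x (le_of_lt hx)
    exact (hγs θ).congr_of_eventuallyEq hev
  -- ### (3) the margin `h`: the path misses `γ [-4h, 4h]`
  have hZ : IsClosed {x : ℝ | γ x ∈ range pth} :=
    (isCompact_range pth.continuous).isClosed.preimage hγc
  have h0Z : (0 : ℝ) ∈ {x : ℝ | γ x ∈ range pth}ᶜ := fun ⟨t, ht⟩ => (hpth t).2 ht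
  obtain ⟨h, hh0, hh16, hhZ⟩ : ∃ h : ℝ, 0 < h ∧ h ≤ 1 / 16 ∧
      ∀ x : ℝ, |x| ≤ 4 * h → γ x ∉ range pth := by
    obtain ⟨ε, hε, hball⟩ := Metric.isOpen_iff.1 hZ.isOpen_compl 0 h0Z
    refine ⟨min (ε / 8) (1 / 16), lt_min (by linarith) (by norm_num), min_le_right _ _,
      fun x hx hmem => hball ?_ hmem⟩
    rw [Metric.mem_ball, Real.dist_eq, sub_zero]
    have : min (ε / 8) (1 / 16) ≤ ε / 8 := min_le_left _ _
    linarith [abs_nonneg x]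
  have hhπ : 2 * h < π := by linarith
  -- ### `L` on the far part: in `O`, and off `γ [-3h, 3h]`
  set Wc : Set V := (γ '' Icc (-(3 * h)) (3 * h))ᶜ with hWcdef
  have hWco : IsOpen Wc := ((isCompact_Icc.image hγc).isClosed).isOpen_compl
  have hLval : ∀ θ ∈ Icc h (2 * π - h), L (circlePoint θ) ∈ O ∧
      (1 / 2 ≤ θ → θ ≤ 2 * π - 1 / 2 → L (circlePoint θ) ∈ Wc) := by
    intro θ hθ
    by_cases hθ1 : θ ≤ 1
    · -- on the arc, to the right of the midpoint
      have hval : L (circlePoint θ) = γ θ := hLγ θ (abs_le.2 ⟨by linarith [hθ.1], hθ1⟩)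
      refine ⟨by rw [hval]; exact hγO θ (by linarith [hθ.1]), fun h12 _ => ?_⟩
      rw [hval]
      rintro ⟨x, hx, hxe⟩
      have := hγinj hxe
      subst this
      linarith [hx.2]
    · by_cases hθ2 : θ < 2 * π - 1
      · -- on the path
        have hval : L (circlePoint θ) ∈ range pth := by
          rw [hL]
          exact hPpth θ ⟨lt_of_not_ge hθ1, hθ2⟩
        refine ⟨(hpthO hval).1, fun _ _ => ?_⟩
        rintro ⟨x, hx, hxe⟩
        refine hhZ x ?_ (hxe ▸ hval)
        rw [abs_le]
        exact ⟨by linarith [hx.1], by linarith [hx.2]⟩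
      · -- on the arc, to the left of the midpoint (one period later)
        rw [not_lt] at hθ2
        have hval : L (circlePoint θ) = γ (θ - 2 * π) := by
          rw [hL, show θ = θ - 2 * π + 2 * π by ring, hPper, sub_add_cancel]
          exact hPγ _ ⟨by linarith, by linarith [hθ.2]⟩
        refine ⟨by rw [hval]; exact hγO _ (by linarith [hθ.2]), fun _ h12 => ?_⟩
        rw [hval]
        rintro ⟨x, hx, hxe⟩
        have := hγinj hxe
        subst this
        linarith [hx.1]
  -- lifts of far points
  have hliftD : ∀ {b : ℝ}, b < π → ∀ u : (Metric.sphere (0 : EuclideanSpace ℝ (Fin 2)) 1), angCos 0 u ≤ Real.cos b →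
      ∃ θ ∈ Icc b (2 * π - b), circlePoint θ = u := fun hbπ u hu =>
    exists_mem_Icc_circlePoint_eq_of_angCos_le hbπ hu
  set D : Set ((Metric.sphere (0 : EuclideanSpace ℝ (Fin 2)) 1)) := {u | angCos 0 u ≤ Real.cos h} with hDdef
  set D' : Set ((Metric.sphere (0 : EuclideanSpace ℝ (Fin 2)) 1)) := {u | angCos 0 u ≤ Real.cos (1 / 2)} with hD'def
  have hDc : IsCompact D := (isClosed_le (continuous_angCos 0) continuous_const).isCompact
  have hD'c : IsCompact D' := (isClosed_le (continuous_angCos 0) continuous_const).isCompact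
  have hLD : MapsTo L D O := fun u hu => by
    obtain ⟨θ, hθ, rfl⟩ := hliftD (by linarith) u hu
    exact (hLval θ hθ).1
  have hLD' : MapsTo L D' Wc := fun u hu => by
    obtain ⟨θ, hθ, rfl⟩ := hliftD (by linarith) u hu
    exact (hLval θ ⟨by linarith [hθ.1], by linarith [hθ.2]⟩).2 hθ.1 hθ.2
  -- ### the closeness family for `L`
  obtain ⟨t₁, r₁, hr₁, hmaps₁, hcov₁⟩ := exists_finset_closedBall_mapsTo hUco hUcy hLc
  -- ### smoothing relative to the arc of angle `1/2`
  have hLW : ContMDiffOn (𝓡 1) (𝓡 n) ∞ L (circleArc 0 1) := fun u hu => by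
    obtain ⟨θ, hθ, rfl⟩ := exists_abs_lt_of_mem_circleArc hu zero_le_one
    rw [sub_zero] at hθ
    exact (hLsmooth θ hθ).contMDiffWithinAt
  obtain ⟨G₀, hG₀s, hG₀L, hG₀cons⟩ := exists_contMDiff_eqOn_mapsTo (IM := 𝓡 1) hLc
    (isClosed_circleClosedArc 0 (1 / 2)) (isOpen_circleArc 0 1)
    (circleClosedArc_subset_arc (by norm_num) (by norm_num) (by linarith)) hLW
    (ι := Bool ⊕ ↥t₁)
    (C := Sum.elim (fun b => cond b D D') (fun k => Metric.closedBall (k : Metric.sphere (0 : EuclideanSpace ℝ (Fin 2)) 1) (r₁ k)))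
    (U := Sum.elim (fun b => cond b O Wc) (fun k => Uc (L k)))
    (fun i => by
      rcases i with b | k
      · cases b <;> assumption
      · exact (Metric.isClosed_closedBall (x := (k : Metric.sphere (0 : EuclideanSpace ℝ (Fin 2)) 1))).isCompact)
    (fun i => by
      rcases i with b | k
      · cases b <;> assumption
      · exact hUco _)
    (fun i => by
      rcases i with b | k
      · cases b <;> assumption
      · exact hmaps₁ k)
  have hG₀D : MapsTo G₀ D O := hG₀cons (Sum.inl true)
  have hG₀D' : MapsTo G₀ D' Wc := hG₀cons (Sum.inl false)
  have hG₀close : ∀ k : ↥t₁, MapsTo G₀ (Metric.closedBall (k : Metric.sphere (0 : EuclideanSpace ℝ (Fin 2)) 1) (r₁ k))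
      (Uc (L k)) := fun k => hG₀cons (Sum.inr k)
  -- `G₀` is `γ` on the arc of angle `1/2`
  have hG₀γ : ∀ θ : ℝ, |θ| ≤ 1 / 2 → G₀ (circlePoint θ) = γ θ := fun θ hθ => by
    rw [hG₀L (circlePoint_mem_circleClosedArc_of_abs_le (by rwa [sub_zero]) (by linarith))]
    exact hLγ θ (by linarith)
  -- ### (4) the smoothed loop is good on the core arc of angle `2h`
  have hgood : StagesGoodOn n (fun p : ℝ × (Metric.sphere (0 : EuclideanSpace ℝ (Fin 2)) 1) => G₀ p.2) (univ ×ˢ circleClosedArc 0 (2 * h)) := by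
    refine stagesGoodOn_const_iff.2 ⟨fun s hs => ?_, fun u u' hu heq => ?_⟩
    · -- velocity: near `s` the lift of `G₀` is a translate of `γ`
      have hs' : circlePoint s ∈ circleArc 0 (3 * h) :=
        circleClosedArc_subset_arc (by linarith) (by linarith) (by linarith) hs
      obtain ⟨s₀, hs₀, hs₀s⟩ := exists_abs_lt_of_mem_circleArc hs' (by linarith)
      rw [sub_zero] at hs₀
      obtain ⟨k, hk⟩ := exists_eq_add_of_circlePoint_eq hs₀s.symm
      -- `s = s₀ + k 2π`
      refine thetaVel_const_ne_zero_of_eventuallyEq_curve (γ := γ) (d := (k : ℝ) * (2 * π)) hγs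
        (hγimm _) ?_
      have ho : IsOpen {r : ℝ | |r - (k : ℝ) * (2 * π)| < 1 / 2} :=
        isOpen_lt (continuous_abs.comp (continuous_id.sub continuous_const)) continuous_const
      have hsmem : s ∈ {r : ℝ | |r - (k : ℝ) * (2 * π)| < 1 / 2} := by
        change |s - (k : ℝ) * (2 * π)| < 1 / 2
        rw [hk, add_sub_cancel_right]
        linarith
      filter_upwards [ho.mem_nhds hsmem] with r hr
      change G₀ (circlePoint r) = γ (r - (k : ℝ) * (2 * π))
      have hcp : circlePoint r = circlePoint (r - (k : ℝ) * (2 * π)) := by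
        rw [circlePoint_eq_circlePoint_iff]
        exact ⟨k, by ring⟩
      rw [hcp]
      exact hG₀γ _ (le_of_lt hr)
    · -- separation
      have hu3 : u ∈ circleArc 0 (3 * h) :=
        circleClosedArc_subset_arc (by linarith) (by linarith) (by linarith) hu
      obtain ⟨θ, hθ, rfl⟩ := exists_abs_lt_of_mem_circleArc hu3 (by linarith)
      rw [sub_zero] at hθ
      have hGu : G₀ (circlePoint θ) = γ θ := hG₀γ θ (by linarith [abs_nonneg θ])
      by_cases hu' : Real.cos (1 / 2) ≤ angCos 0 u'
      · -- `u'` on the arc of angle `1/2`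
        have hu'' : u' ∈ circleArc 0 (3 / 4) :=
          circleClosedArc_subset_arc (by norm_num) (by norm_num) (by linarith) hu'
        obtain ⟨θ', hθ', rfl⟩ := exists_abs_lt_of_mem_circleArc hu'' (by norm_num)
        rw [sub_zero] at hθ'
        have hGu' : G₀ (circlePoint θ') = γ θ' := by
          rw [hG₀L ?_]
          · exact hLγ θ' (by linarith)
          · exact hu'
        rw [hGu, hGu'] at heq
        rw [hγinj heq]
      · -- `u' ∈ D'`: its image is off `γ [-3h, 3h]`, contradiction
        have hmem : G₀ u' ∈ Wc := hG₀D' (le_of_not_ge hu')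
        rw [← heq, hGu] at hmem
        exact absurd ⟨θ, ⟨by linarith [abs_lt.1 hθ |>.1], by linarith [abs_lt.1 hθ |>.2]⟩, rfl⟩
          hmem
  -- ### the closeness family for `G₀`, and general position away from the arc of angle `h`
  obtain ⟨t₂, r₂, hr₂, hmaps₂, hcov₂⟩ := exists_finset_closedBall_mapsTo hUco hUcy hG₀s.continuous
  obtain ⟨e, hes, hemb, hecons, heG₀⟩ := exists_isSmoothEmbedding_of_stagesGoodOn_core hn hG₀s
    hh0 (by linarith) hhπ hgood (ι := Unit ⊕ ↥t₂)
    (C := Sum.elim (fun _ => D) (fun k => Metric.closedBall (k : Metric.sphere (0 : EuclideanSpace ℝ (Fin 2)) 1) (r₂ k)))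
    (U := Sum.elim (fun _ => O) (fun k => Uc (G₀ k)))
    (fun i => by
      rcases i with _ | k
      · exact hDc
      · exact (Metric.isClosed_closedBall (x := (k : Metric.sphere (0 : EuclideanSpace ℝ (Fin 2)) 1))).isCompact)
    (fun i => by
      rcases i with _ | k
      · exact hO
      · exact hUco _)
    (fun i => by
      rcases i with _ | k
      · exact hG₀D
      · exact hmaps₂ k)
  have heD' : MapsTo e D O := hecons (Sum.inl ())
  have heclose : ∀ k : ↥t₂, MapsTo e (Metric.closedBall (k : Metric.sphere (0 : EuclideanSpace ℝ (Fin 2)) 1) (r₂ k))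
      (Uc (G₀ k)) := fun k => hecons (Sum.inr k)
  have heγ : ∀ θ : ℝ, |θ| ≤ h → e (circlePoint θ) = γ θ := fun θ hθ => by
    rw [heG₀ (circlePoint_mem_circleClosedArc_of_abs_le (by rwa [sub_zero]) (by linarith))]
    exact hG₀γ θ (by linarith)
  -- ### (5) the three circle maps are homotopic without moving the base point
  set L' : C((Metric.sphere (0 : EuclideanSpace ℝ (Fin 2)) 1), V) := ⟨L, hLc⟩ with hL'def
  set G₀' : C((Metric.sphere (0 : EuclideanSpace ℝ (Fin 2)) 1), V) := ⟨G₀, hG₀s.continuous⟩ with hG₀'def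
  set e' : C((Metric.sphere (0 : EuclideanSpace ℝ (Fin 2)) 1), V) := ⟨e, hes.continuous⟩ with he'def
  have hL0 : L (circlePoint 0) = γ 0 := hLγ 0 (by simp)
  have hG₀0 : G₀ (circlePoint 0) = γ 0 := hG₀γ 0 (by simp)
  have he0 : e (circlePoint 0) = γ 0 := heγ 0 (by simp [hh0.le])
  obtain ⟨H₁, hH₁⟩ := hUc L' G₀' fun u => by
    have hu : u ∈ ⋃ k ∈ t₁, Metric.closedBall k (r₁ k) := by rw [hcov₁]; trivial
    obtain ⟨k, hk, hku⟩ := mem_iUnion₂.1 hu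
    exact ⟨L k, hmaps₁ k hku, hG₀close ⟨k, hk⟩ hku⟩
  obtain ⟨H₂, hH₂⟩ := hUc G₀' e' fun u => by
    have hu : u ∈ ⋃ k ∈ t₂, Metric.closedBall k (r₂ k) := by rw [hcov₂]; trivial
    obtain ⟨k, hk, hku⟩ := mem_iUnion₂.1 hu
    exact ⟨G₀ k, hmaps₂ k hku, heclose ⟨k, hk⟩ hku⟩
  have hfix₁ : ∀ s, H₁ (s, circlePoint 0) = L' (circlePoint 0) := fun s =>
    hH₁ s _ (by show L (circlePoint 0) = G₀ (circlePoint 0); rw [hL0, hG₀0])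
  have hfix₂ : ∀ s, H₂ (s, circlePoint 0) = G₀' (circlePoint 0) := fun s =>
    hH₂ s _ (by show G₀ (circlePoint 0) = e (circlePoint 0); rw [hG₀0, he0])
  have hLG : L'.circleLoop.Homotopic (G₀'.circleLoop.cast _ _) :=
    ContinuousMap.circleLoop_homotopic_cast_of_homotopy H₁ hfix₁
  have hGe : G₀'.circleLoop.Homotopic (e'.circleLoop.cast _ _) :=
    ContinuousMap.circleLoop_homotopic_cast_of_homotopy H₂ hfix₂
  -- ### (6) the loop of `L` is `Ap · pth · Am`, up to reparametrisation along `P`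
  have hkey : (L'.circleLoop.cast hL0.symm hL0.symm).Homotopic ((Ap.trans pth).trans Am) := by
    -- the parameter function of the concatenation
    set p₂ : I → ℝ := fun t => if (t : ℝ) ≤ 1 / 4 then 4 * (t : ℝ)
      else if (t : ℝ) ≤ 1 / 2 then 1 + (4 * (t : ℝ) - 1) * (2 * π - 2)
      else 2 * (t : ℝ) - 2 + 2 * π with hp₂def
    have hp₂c : Continuous p₂ := by
      refine Continuous.if_le ?_ ?_ continuous_subtype_val continuous_const (fun t ht => ?_)
      · fun_prop
      · refine Continuous.if_le ?_ ?_ continuous_subtype_val continuous_const (fun t ht => ?_)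
        · fun_prop
        · fun_prop
        · rw [ht]; ring
      · rw [ht]; norm_num
    refine homotopic_of_comp_real hPc _ _ (fun t => 2 * π * (t : ℝ)) p₂ (by fun_prop) hp₂c
      (fun t => ?_) (fun t => ?_) (by simp [hp₂def]) (by norm_num [hp₂def])
    · -- the loop of `L`
      show L (circleParam t) = P (2 * π * (t : ℝ))
      rw [circleParam_apply, hL]
    · -- the concatenation
      rw [Path.trans_apply]
      split_ifs with ht
      · rw [Path.trans_apply]
        split_ifs with ht'
        · rw [hAp]
          have ht2 : 2 * (t : ℝ) ≤ 1 / 2 := ht'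
          have ht4 : (t : ℝ) ≤ 1 / 4 := by linarith
          have hp : p₂ t = 4 * (t : ℝ) := by simp only [hp₂def, if_pos ht4]
          rw [hp]
          show γ (2 * (2 * (t : ℝ))) = P (4 * (t : ℝ))
          rw [hPγ _ ⟨by linarith [t.2.1], by linarith⟩]
          ring_nf
        · have ht2 : ¬ 2 * (t : ℝ) ≤ 1 / 2 := ht'
          have ht4 : ¬ (t : ℝ) ≤ 1 / 4 := fun h4 => ht2 (by linarith)
          have hp : p₂ t = 1 + (4 * (t : ℝ) - 1) * (2 * π - 2) := by
            simp only [hp₂def, if_neg ht4, if_pos ht]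
          rw [hp]
          have hs01 : 2 * (2 * (t : ℝ)) - 1 ∈ Icc (0 : ℝ) 1 :=
            ⟨by linarith [not_le.1 ht4], by linarith⟩
          have hθI : 1 + (4 * (t : ℝ) - 1) * (2 * π - 2) ∈ Icc (1 : ℝ) (2 * π - 1) := by
            constructor
            · have : 0 ≤ (4 * (t : ℝ) - 1) := by linarith [not_le.1 ht4]
              nlinarith
            · have : (4 * (t : ℝ) - 1) ≤ 1 := by linarith
              nlinarith
          rw [hPpth' _ hθI]
          have hne : (2 * π - 2 : ℝ) ≠ 0 := by linarith
          have hdiv : (1 + (4 * (t : ℝ) - 1) * (2 * π - 2) - 1) / (2 * π - 2) =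
              2 * (2 * (t : ℝ)) - 1 := by
            rw [div_eq_iff hne]
            ring
          rw [hdiv, Path.extend_apply pth hs01]
      · rw [hAm]
        have ht4 : ¬ (t : ℝ) ≤ 1 / 4 := fun h4 => ht (by linarith)
        have hp : p₂ t = 2 * (t : ℝ) - 2 + 2 * π := by
          simp only [hp₂def, if_neg ht4, if_neg ht]
        rw [hp, hPper]
        show γ (2 * (t : ℝ) - 1 - 1) = P (2 * (t : ℝ) - 2)
        rw [hPγ _ ⟨by linarith [not_le.1 ht], by linarith [t.2.2]⟩]
        ring_nf
  -- ### assembly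
  refine ⟨e', hemb, he0, ?_, ?_, he0.symm, ?_⟩
  · -- the rest of the circle goes through `O`
    intro s hs
    change e s ∈ O
    by_cases hsD : angCos 0 s ≤ Real.cos h
    · exact heD' hsD
    · obtain ⟨θ, hθ, rfl⟩ := exists_abs_lt_of_mem_circleArc (lt_of_not_ge hsD) hh0.le
      rw [sub_zero] at hθ
      rw [heγ θ hθ.le]
      refine hγO θ fun h0 => hs ?_
      subst h0
      rfl
  · -- near `γ 0` the image is the arc
    set T : Set V := γ '' (Icc (-1 : ℝ) 1 ∩ {x | h ≤ |x|}) with hTdef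
    have hTc : IsClosed T :=
      ((isCompact_Icc.inter_right (isClosed_le continuous_const continuous_abs)).image hγc).isClosed
    have heDc : IsClosed (e '' D) := (hDc.image hes.continuous).isClosed
    refine ⟨(e '' D)ᶜ ∩ Tᶜ, ?_, ?_⟩
    · refine (heDc.isOpen_compl.inter hTc.isOpen_compl).mem_nhds ⟨?_, ?_⟩
      · rintro ⟨u, huD, hue⟩
        have hu0 : u = circlePoint 0 := hemb.isEmbedding.injective (hue.trans (heγ 0 (by simp [hh0.le])).symm)
        subst hu0
        have : angCos 0 (circlePoint 0) ≤ Real.cos h := huD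
        rw [angCos_circlePoint, sub_zero, Real.cos_zero] at this
        have hlt : Real.cos h < Real.cos 0 :=
          Real.cos_lt_cos_of_nonneg_of_le_pi le_rfl (by linarith) hh0
        rw [Real.cos_zero] at hlt
        linarith
      · rintro ⟨x, ⟨-, hx⟩, hxe⟩
        have := hγinj hxe
        subst this
        simp only [mem_setOf_eq, abs_zero] at hx
        linarith
    · ext y
      constructor
      · rintro ⟨⟨u, rfl⟩, huD, huT⟩
        have huD' : ¬ angCos 0 u ≤ Real.cos h := fun hc => huD ⟨u, hc, rfl⟩
        obtain ⟨θ, hθ, rfl⟩ := exists_abs_lt_of_mem_circleArc (lt_of_not_ge huD') hh0.le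
        rw [sub_zero] at hθ
        refine ⟨⟨θ, ⟨by linarith [abs_lt.1 hθ |>.1], by linarith [abs_lt.1 hθ |>.2]⟩,
          (heγ θ hθ.le).symm⟩, huD, huT⟩
      · rintro ⟨⟨x, hx, rfl⟩, hD, hT⟩
        have hxh : |x| < h := by
          by_contra hc
          exact hT ⟨x, ⟨hx, le_of_not_gt hc⟩, rfl⟩
        exact ⟨⟨circlePoint x, heγ x hxh.le⟩, hD, hT⟩
  · -- the class of the loop
    have h1 : (G₀'.circleLoop.cast hG₀0.symm hG₀0.symm).Homotopic
        (L'.circleLoop.cast hL0.symm hL0.symm) :=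
      (hLG.pathCast hL0.symm hL0.symm).symm
    have h2 : (e'.circleLoop.cast he0.symm he0.symm).Homotopic
        (G₀'.circleLoop.cast hG₀0.symm hG₀0.symm) :=
      (hGe.pathCast hG₀0.symm hG₀0.symm).symm
    exact h2.trans (h1.trans hkey)

end ArcClosing

end Literature.Topology.FourManifolds
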